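import Summits.ResolutionOfSingularities.ResolutionOfSingularities.Theorems.FrobeniusClosingPatchingRelPerfectDepthWeightTwoBPieces
import Summits.ResolutionOfSingularities.ResolutionOfSingularities.Theorems.FrobeniusClosingPatchingRelPerfectDepthWeightTwoBStepLaw
import Literature.AlgebraicGeometry.Resolution.BlowupDisjointCentreSplitting
import Literature.AlgebraicGeometry.Resolution.BlowupDisjointCentreTransport
import Literature.AlgebraicGeometry.Resolution.CartierDivisorControlledTransform
import Literature.AlgebraicGeometry.Resolution.HasSNCWithOffCentre
import Literature.AlgebraicGeometry.Resolution.PermissibleStalkTransport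
import HarnessLib

/-!
# Crux `PatchingRelPerfect` (stmt-ResolutionOfSingularities-16161), chain W5.2 — TargetsF5J/JR T5-E «W₂B-maxweight»:
# the NEXT-PIECE glue — the CJS-side data of a REMAINING centre piece after blowing up a DISJOINT piece

[OURS · L1 W5.2 · TargetsF5J/JR T5-E brick (L-F)] Fact-free; NOT statements of the manuscript under review.
A Cossart–Jannsen–Saito centre may be disconnected; the E-side transport of T5-E blows up its connected components one at a
time (res-type-002's splitting `IsBlowup.exists_comp_eq_of_isPiecePartition_cons`, BGMW 2011 §4 Step 2b), each with its
own maximal weight. After the blowing up `τ₁ : W₁ → W` of the FIRST piece `Z₁` (along its reduced ideal `𝓘(Z₁)`), the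
single-piece step of res-D-pv-054's `…DepthWeightTwoBPieceStep` (`WeightTwoB.PieceIn`) must be fed, for each remaining
piece `Z₂` (disjoint from `Z₁`), the CJS-side data of the LIFTED piece `τ₁⁻¹Z₂` with respect to the transported state
`(τ₁ᶜ(𝔟, ν), τ₁ᶜ(D, m), stepExp ℬ …)`. Since `τ₁` is an isomorphism over `W ∖ Z₁ ⊇ Z₂` (Stacks 02OS), everything
transports; this file packages the transport over the tree's disjoint-piece kits (res-type-002 `BlowupDisjointCentreSplitting` /
`BlowupDisjointCentreTransport`, res-D-pv-026 `BlowupDisjointCentreWeights` / `CartierDivisorControlledTransform`,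
`HasSNCWithOffCentre`, res-type-049 `PermissibleStalkTransport`):

* `nextPiece_comap_eq` — `𝓘(Z₂)·𝒪_{W₁} = 𝓘(τ₁⁻¹Z₂)` and `Supp = τ₁⁻¹Z₂`;
* `nextPiece_exists_isGenericPoint` — the generic point of `Z₂` lifts (field `gen`);
* `nextPiece_isRegular` — `V(𝓘(τ₁⁻¹Z₂))` is regular (field `regZ`); `nextPiece_isPreconnected`;
* `nextPiece_subset_support_controlledTransform` — `τ₁⁻¹Z₂ ⊆ Supp τ₁ᶜ(D, b)` from `Z₂ ⊆ Supp D` (field `subZ`);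
* `nextPiece_hasSNCWith_stepExp` — `HasSNCWith (boundaryOf (stepExp ℬ τ₁ 𝓘(Z₁) e)) 𝓘(τ₁⁻¹Z₂)` from
  `HasSNCWith (boundaryOf ℬ) 𝓘(Z₁)` and `HasSNCWith (boundaryOf ℬ) 𝓘(Z₂)` (field `sncZ`);
* `nextPiece_pieceWeight` — `pieceWeight (τ₁ᶜ(𝔟, b)) (τ₁⁻¹Z₂) = pieceWeight 𝔟 Z₂` (the maximal weight of the piece is
  unchanged);
* `nextPiece_perm` — the CJS permissibility clause at the points of the lifted piece for the reduced zero-scheme of the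
  transported host (field `perm`).

AI-written; AI review is weaker than expert review.

## References
* E. Bierstone, D. Grigoriev, P. Milman, J. Włodarczyk, arXiv:1206.3090, §4 Step 2b, Def. 3.1.3 (2)/(4).
  [BierstoneGrigorievMilmanWlodarczyk2011]
* V. Cossart, U. Jannsen, S. Saito, LNM 2270 (2020), Def. 3.1 (2), Def. 4.1, (6.2). [CossartJannsenSaito2020]
* The Stacks Project, Tag 02OS. [StacksProject]
-/

-- `Summit.<Summit>.<Sub>.Theorems` with `Sub = Summit` (single-conjunct summit, D-0017)
set_option linter.dupNamespace false

noncomputable section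

open CategoryTheory CategoryTheory.Limits AlgebraicGeometry TopologicalSpace IsLocalRing
open Literature.AlgebraicGeometry.Resolution Scheme.IdealSheafData

namespace Summit.ResolutionOfSingularities.ResolutionOfSingularities.Theorems

universe u

namespace WeightTwoB

variable {W W₁ : Scheme.{u}} {τ₁ : W₁ ⟶ W} {Z₁ Z₂ : Closeds W}
  (hτ₁ : IsBlowup τ₁ (vanishingIdeal Z₁)) (hZ : Disjoint (Z₁ : Set W) (Z₂ : Set W))

include hZ in
/-- The supports of the reduced ideals of two disjoint closed sets are disjoint. [folklore] -/
private theorem disjoint_supports :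
    Disjoint ((vanishingIdeal Z₁).support : Set W) ((vanishingIdeal Z₂).support : Set W) := by
  rwa [Scheme.IdealSheafData.coe_support_vanishingIdeal, Scheme.IdealSheafData.coe_support_vanishingIdeal]

include hZ in
/-- `Z₂` is disjoint from the centre `V(𝓘(Z₁)) = Z₁`. [folklore] -/
private theorem disjoint_support₁ : Disjoint (Z₂ : Set W) ((vanishingIdeal Z₁).support : Set W) := by
  rw [Scheme.IdealSheafData.coe_support_vanishingIdeal]; exact hZ.symm

include hτ₁ hZ

/-- **The reduced ideal of the remaining piece pulls back to the reduced ideal of the lifted piece**: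
`𝓘(Z₂)·𝒪_{W₁} = 𝓘(τ₁⁻¹Z₂)` (tree `IsBlowup.comap_vanishingIdeal_of_disjoint`, Stacks 02OS / 033B).
[cite: StacksProject, Tag 02OS] -/
theorem nextPiece_comap_eq [IsLocallyNoetherian W] :
    (vanishingIdeal Z₂).comap τ₁ = vanishingIdeal (Z₂.preimage τ₁.continuous) :=
  hτ₁.comap_vanishingIdeal_of_disjoint Z₂ (disjoint_support₁ hZ)

/-- Its support is the lifted piece `τ₁⁻¹Z₂`. [cite: StacksProject, Tag 02OS] -/
theorem nextPiece_support_comap [IsLocallyNoetherian W] :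
    (((vanishingIdeal Z₂).comap τ₁).support : Set W₁) = (Z₂.preimage τ₁.continuous : Set W₁) := by
  rw [nextPiece_comap_eq hτ₁ hZ, Scheme.IdealSheafData.coe_support_vanishingIdeal]

/-- **Field `gen`: the generic point of the piece lifts** — `τ₁⁻¹Z₂` has a generic point over that of `Z₂`
(res-type-002's `IsBlowup.exists_isGenericPoint_support_comap_of_disjoint`). [cite: StacksProject, Tag 02OS] -/
theorem nextPiece_exists_isGenericPoint [IsLocallyNoetherian W] {η₂ : W} (hη : IsGenericPoint η₂ (Z₂ : Set W)) :
    ∃ η₂' : W₁, IsGenericPoint η₂' (Z₂.preimage τ₁.continuous : Set W₁) ∧ τ₁ η₂' = η₂ := by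
  have hη' : IsGenericPoint η₂ (((vanishingIdeal Z₂).support : Set W)) := by rwa [Scheme.IdealSheafData.coe_support_vanishingIdeal]
  obtain ⟨η₂', h1, h2⟩ := hτ₁.exists_isGenericPoint_support_comap_of_disjoint (disjoint_supports hZ) hη'
  exact ⟨η₂', by rwa [nextPiece_support_comap hτ₁ hZ] at h1, h2⟩

/-- **Field `regZ`: the lifted piece is a regular closed subscheme** (res-type-002's
`IsBlowup.isRegular_subscheme_vanishingIdeal_preimage_of_disjoint`). [cite: BierstoneGrigorievMilmanWlodarczyk2011, §4 Step 2b] -/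
theorem nextPiece_isRegular [IsLocallyNoetherian W] (hreg : Scheme.IsRegular (vanishingIdeal Z₂).subscheme) :
    Scheme.IsRegular (vanishingIdeal (Z₂.preimage τ₁.continuous)).subscheme :=
  hτ₁.isRegular_subscheme_vanishingIdeal_preimage_of_disjoint hZ hreg

/-- The lifted piece is irreducible if the piece is (res-type-002's `IsBlowup.isIrreducible_preimage_of_disjoint'`).
[cite: BierstoneGrigorievMilmanWlodarczyk2011, §4 Step 2b] -/
theorem nextPiece_isIrreducible (hirr : IsIrreducible (Z₂ : Set W)) :
    IsIrreducible (Z₂.preimage τ₁.continuous : Set W₁) :=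
  hτ₁.isIrreducible_preimage_of_disjoint' hZ hirr

/-- `IsPreconnected` form of the same (the `cons` clause of `IsWeightedSeqJR` asks the centre to be connected).
[cite: BierstoneGrigorievMilmanWlodarczyk2011, §4 Step 2b] -/
theorem nextPiece_isPreconnected (hirr : IsIrreducible (Z₂ : Set W)) :
    _root_.IsPreconnected ((vanishingIdeal (Z₂.preimage τ₁.continuous)).support : Set W₁) := by
  rw [Scheme.IdealSheafData.coe_support_vanishingIdeal]
  exact (nextPiece_isIrreducible hτ₁ hZ hirr).2.isPreconnected

/-- **Field `subZ`: the lifted piece lies on the transported host** — `τ₁⁻¹Z₂ ⊆ Supp τ₁ᶜ(D, b)` for every weight `b`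
when `Z₂ ⊆ Supp D` (off the centre the controlled transform is the total transform).
[cite: BierstoneGrigorievMilmanWlodarczyk2011, §3.2] -/
theorem nextPiece_subset_support_controlledTransform {D : W.IdealSheafData} (b : ℕ)
    (hsub : (Z₂ : Set W) ⊆ (D.support : Set W)) :
    (Z₂.preimage τ₁.continuous : Set W₁) ⊆ ((controlledTransform τ₁ (vanishingIdeal Z₁) D b).support : Set W₁) := by
  intro y hy
  have hy₂ : τ₁ y ∈ (Z₂ : Set W) := hy
  have hy₁ : τ₁ y ∉ ((vanishingIdeal Z₁).support : Set W) := by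
    rw [Scheme.IdealSheafData.coe_support_vanishingIdeal]
    exact fun h => Set.disjoint_left.mp hZ h hy₂
  exact (hτ₁.mem_support_controlledTransform_iff_of_not_mem b hy₁).mpr (hsub hy₂)

/-- **Field `sncZ`: the transported boundary has simple normal crossings with the lifted piece** — from snc of the
boundary with BOTH pieces downstairs (`HasSNCWith.transform_comap_of_disjoint`, Kollár Def. 3.25 over the first piece,
stalk isomorphism over the second). [cite: BierstoneGrigorievMilmanWlodarczyk2011, Def. 3.1.3 (2), (4); §4 Step 2b] -/
theorem nextPiece_hasSNCWith [IsLocallyNoetherian W] [IsLocallyNoetherian W₁] {E : List W.IdealSheafData} (h₁ : HasSNCWith E (vanishingIdeal Z₁))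
    (h₂ : HasSNCWith E (vanishingIdeal Z₂)) :
    HasSNCWith (E.map (strictTransformIdeal τ₁ (vanishingIdeal Z₁)) ++ [(vanishingIdeal Z₁).comap τ₁])
      (vanishingIdeal (Z₂.preimage τ₁.continuous)) := by
  rw [← nextPiece_comap_eq hτ₁ hZ]
  exact h₁.transform_comap_of_disjoint hτ₁ h₂ (disjoint_supports hZ)

/-- The same for an exponent list: `HasSNCWith (boundaryOf (stepExp ℬ τ₁ 𝓘(Z₁) e)) 𝓘(τ₁⁻¹Z₂)` (res-D-pv-054's
`boundaryOf_stepExp`). [cite: BierstoneGrigorievMilmanWlodarczyk2011, Def. 3.1.3 (2), (4)] -/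
theorem nextPiece_hasSNCWith_stepExp [IsLocallyNoetherian W] [IsLocallyNoetherian W₁] {ℬ : List (W.IdealSheafData × ℕ)} (e : ℕ)
    (h₁ : HasSNCWith (boundaryOf ℬ) (vanishingIdeal Z₁)) (h₂ : HasSNCWith (boundaryOf ℬ) (vanishingIdeal Z₂)) :
    HasSNCWith (boundaryOf (stepExp ℬ τ₁ (vanishingIdeal Z₁) e)) (vanishingIdeal (Z₂.preimage τ₁.continuous)) := by
  rw [boundaryOf_stepExp]
  exact nextPiece_hasSNCWith hτ₁ hZ h₁ h₂

/-- **The maximal weight of the piece is unchanged**: `pieceWeight (τ₁ᶜ(𝔟, b)) (τ₁⁻¹Z₂) = pieceWeight 𝔟 Z₂` (orders at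
the points of the lifted piece are those at their images, res-type-002's
`IsBlowup.forall_le_idealOrder_controlledTransform_iff_of_disjoint`). [cite: BierstoneGrigorievMilmanWlodarczyk2011, Lemma 8.0.3 (2)] -/
theorem nextPiece_pieceWeight [IsLocallyNoetherian W] (𝔟 : W.IdealSheafData) (b : ℕ) :
    pieceWeight (controlledTransform τ₁ (vanishingIdeal Z₁) 𝔟 b) (Z₂.preimage τ₁.continuous : Set W₁) =
      pieceWeight 𝔟 (Z₂ : Set W) := by
  have key := hτ₁.forall_le_idealOrder_controlledTransform_iff_of_disjoint (disjoint_supports hZ) 𝔟 b 2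
  rw [nextPiece_support_comap hτ₁ hZ, Scheme.IdealSheafData.coe_support_vanishingIdeal] at key
  by_cases h : ∀ z ∈ (Z₂ : Set W), (2 : ℕ∞) ≤ idealOrder 𝔟 z
  · rw [(pieceWeight_eq_two_iff _ _).mpr h, (pieceWeight_eq_two_iff _ _).mpr (key.mpr h)]
  · have h2 : pieceWeight 𝔟 (Z₂ : Set W) = 1 := by
      have := one_le_pieceWeight 𝔟 (Z₂ : Set W)
      have := pieceWeight_le_two 𝔟 (Z₂ : Set W)
      have hne : pieceWeight 𝔟 (Z₂ : Set W) ≠ 2 := fun e => h ((pieceWeight_eq_two_iff _ _).mp e)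
      omega
    have h2' : pieceWeight (controlledTransform τ₁ (vanishingIdeal Z₁) 𝔟 b) (Z₂.preimage τ₁.continuous : Set W₁) = 1 := by
      have := one_le_pieceWeight (controlledTransform τ₁ (vanishingIdeal Z₁) 𝔟 b) (Z₂.preimage τ₁.continuous : Set W₁)
      have := pieceWeight_le_two (controlledTransform τ₁ (vanishingIdeal Z₁) 𝔟 b) (Z₂.preimage τ₁.continuous : Set W₁)
      have hne : pieceWeight (controlledTransform τ₁ (vanishingIdeal Z₁) 𝔟 b) (Z₂.preimage τ₁.continuous : Set W₁) ≠ 2 :=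
        fun e => h (key.mp ((pieceWeight_eq_two_iff _ _).mp e))
      omega
    rw [h2, h2']

/-- **Field `perm`: the CJS permissibility clause at the points of the lifted piece**, for the reduced zero-scheme of the
transported host `τ₁ᶜ(D, m)`, from the clause at the points of `Z₂` for the reduced zero-scheme of `D` — the weight
condition being the same by `nextPiece_pieceWeight` (res-type-049's `IsBlowup.isPermissible_map_stalkIdeal_of_not_mem_support'`).
[cite: CossartJannsenSaito2020, Def. 3.1 (2), (6.2)] [cite: StacksProject, Tag 02OS] -/
theorem nextPiece_perm [IsLocallyNoetherian W] {𝔟 D : W.IdealSheafData} (b m : ℕ)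
    (h : pieceWeight 𝔟 (Z₂ : Set W) = 1 → ∀ z ∈ (Z₂ : Set W),
      ((stalkIdeal (vanishingIdeal Z₂) z).map
        (Ideal.Quotient.mk (stalkIdeal (vanishingIdeal D.support) z))).IsPermissible) :
    pieceWeight (controlledTransform τ₁ (vanishingIdeal Z₁) 𝔟 b) (Z₂.preimage τ₁.continuous : Set W₁) = 1 →
      ∀ y ∈ (Z₂.preimage τ₁.continuous : Set W₁),
        ((stalkIdeal (vanishingIdeal (Z₂.preimage τ₁.continuous)) y).map
          (Ideal.Quotient.mk (stalkIdeal (vanishingIdeal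
            (controlledTransform τ₁ (vanishingIdeal Z₁) D m).support) y))).IsPermissible := by
  intro hw y hy
  rw [nextPiece_pieceWeight hτ₁ hZ] at hw
  have hy₂ : τ₁ y ∈ (Z₂ : Set W) := hy
  have hy₁ : τ₁ y ∉ ((vanishingIdeal Z₁).support : Set W) := by
    rw [Scheme.IdealSheafData.coe_support_vanishingIdeal]
    exact fun h' => Set.disjoint_left.mp hZ h' hy₂
  refine hτ₁.isPermissible_map_stalkIdeal_of_not_mem_support' hy₁ D (vanishingIdeal Z₂) m ?_ (h hw _ hy₂)
  rw [nextPiece_comap_eq hτ₁ hZ]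

end WeightTwoB

end Summit.ResolutionOfSingularities.ResolutionOfSingularities.Theorems

end
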